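import Summits.RiemannHypothesis.RiemannHypothesis.Theorems.JensenPolynomialsFarGumbelSaddleEstimates
import Summits.RiemannHypothesis.RiemannHypothesis.Theorems.JensenPolynomialsFarGumbelXi0Box
import Summits.RiemannHypothesis.RiemannHypothesis.Theorems.JensenPolynomialsSaddleExists

/-!
# Route `JensenPolynomials`, FAR crux `XiWindowZeroFreeRelFar` (B1-rel far) — S3 WANTED item (L1): the saddle
(RH-FREE; cell rh-jensen, HUMAN RULING D-0040)

Item `stmt-RiemannHypothesis-19465`, stub S3 `stub_laplaceFar`, WANTED list v3 (HOME `eng-4/S3/S3-WANTED.lean`), item (L1)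
`wanted_saddle` (name + signature verbatim): for the far mode `υ` and `‖a‖ ≤ (9/25)υ²` there is a point `u_s` of the disc
`‖u_s − u₀‖ ≤ 1/(10υ²)`, `u₀ = υ + ξ₀/4` (`ξ₀ = farXi0 w (1/υ)`, `w = farW(a/υ²)`), with `‖Ψ′(u_s)‖ ≤ 6` — in fact an
EXACT zero of `Ψ′ = farPsi1 M a` (the complex saddle of the far phase).

Proof. Newton–Kantorovich (`WindowEGF.exists_zero_near_of_hasDerivAt`) for `g = Ψ′`, `g′ = Ψ″` on the disc about `u₀`
with `d = Ψ″(u₀)` and Lipschitz slack `q‖d‖ = 180Λ·ρ` from `‖Ψ‴‖ ≤ 180Λ` on the window box (`norm_farPsi3_le`; the disc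
lies in the box by (L0) `wanted_xi0_box`). The two sizes at the centre come from the EXACT closed forms of
`JensenPolynomialsFarGumbelSaddleEstimates`: with `ε = 1/υ`,
`L = Log w`, `θ = εL(1/4 − w/2)`, `s = ε(L+θ)/4` (so `u₀ = υ(1+s)`), `P = 2s + s²` (so `u₀² + a = υ²(1+wP)/w`),
`2M − 1 = υ(4Λ − 9 − ε)` and `πe^{4u₀} = Λwe^{θ}`:
`Ψ′(u₀) = −4Λw(e^θ − R) + J₁`, `Ψ″(u₀) = −16Λw(e^θ − (ε/4)Q) + J₂` (`R = (1+s)/(1+wP)`, `Q = (1−2w−wP)/(1+wP)²`,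
`‖J₁‖ ≤ 25`, `‖J₂‖ ≤ 4`), and the second-order cancellation
`e^θ − R = (e^θ − 1 − θ) + (θwP − (ε/4)θ(1−2w) + ws²)/(1+wP)` gives `‖e^θ − R‖ ≤ 0.33ε²` while `‖e^θ − (ε/4)Q‖ ≥ 9/10`;
so `‖Ψ′(u₀)‖ ≤ 1.32Λ‖w‖ε² + 25 ≤ (ε²/10)(‖Ψ″(u₀)‖ − 18Λε²)` since `‖w‖ ≥ 25/34` and `Λ ≥ 1000υ²`.
(Numerically `‖e^θ − R‖ ≤ 0.161ε²` and `‖e^θ − (ε/4)Q‖ ≥ 1.0004`; the crude constants keep a 7 % margin.)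
WHAT THIS IS NOT: elementary bookkeeping about an explicit phase function; nothing here bears on the zeros of `ζ` or RH.
-/

noncomputable section
-- D-0017: `Summit.RiemannHypothesis.RiemannHypothesis.…` duplicates the namespace BY DESIGN (single-problem summit).
set_option linter.dupNamespace false

namespace Summit.RiemannHypothesis.RiemannHypothesis.Theorems.JensenPolynomials.FarGumbel

open Complex Metric
open scoped Real

/-- `Λ = πe^{4υ} ≥ 1000·υ²` for `υ ≥ 189/20`. -/
theorem farLam_ge_sq {υ : ℝ} (hυ : (189 / 20 : ℝ) ≤ υ) : 1000 * υ ^ 2 ≤ farLam υ := by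
  rw [farLam]
  have h1 : 1 + υ + υ ^ 2 / 2 ≤ Real.exp υ := Real.quadratic_le_exp_of_nonneg (by linarith)
  have h2 : υ ^ 2 / 2 ≤ Real.exp υ := by linarith
  have h4 : Real.exp (4 * υ) = Real.exp υ ^ 4 := by rw [← Real.exp_nat_mul]; norm_num
  have hp : (υ ^ 2 / 2) ^ 4 ≤ Real.exp υ ^ 4 := pow_le_pow_left₀ (by positivity) h2 4
  have hυ2 : (89 : ℝ) ≤ υ ^ 2 := by nlinarith
  have hυ6 : (89 : ℝ) ^ 3 ≤ (υ ^ 2) ^ 3 := pow_le_pow_left₀ (by norm_num) hυ2 3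
  have e : (υ ^ 2 / 2) ^ 4 = (υ ^ 2) ^ 3 * υ ^ 2 / 16 := by ring
  rw [e] at hp
  have h3 : (89 : ℝ) ^ 3 * υ ^ 2 ≤ (υ ^ 2) ^ 3 * υ ^ 2 := mul_le_mul_of_nonneg_right hυ6 (sq_nonneg υ)
  rw [h4]
  nlinarith [Real.pi_gt_three, pow_nonneg (Real.exp_pos υ).le 4]

/-- **(L1) of the S3 WANTED list v3: the saddle.** For the far mode `υ` (`4πe^{4υ}υ = 2M + 9υ`, `υ ≥ 189/20`) and
`‖a‖ ≤ (9/25)υ²` there is `u_s` with `‖u_s − (υ + ξ₀/4)‖ ≤ 1/(10υ²)` and `‖Ψ′(u_s)‖ ≤ 6` (indeed `Ψ′(u_s) = 0`). -/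
theorem wanted_saddle (M : ℕ) (hM : 2 * 10 ^ 18 ≤ M) (υ : ℝ)
    (hυ : (189 / 20 : ℝ) ≤ υ ∧ 4 * Real.pi * Real.exp (4 * υ) * υ = 2 * (M : ℝ) + 9 * υ)
    (a : ℂ) (ha : ‖a‖ ≤ (9 / 25 : ℝ) * υ ^ 2) :
    ∃ u_s : ℂ, ‖u_s - ((υ : ℂ) + farXi0 (farW (a / (υ : ℂ) ^ 2)) (1 / υ) / 4)‖ ≤ 1 / (10 * υ ^ 2) ∧
      ‖farPsi1 M a u_s‖ ≤ 6 := by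
  obtain ⟨hυ0, hmode⟩ := hυ
  have hM1 : 1 ≤ M := le_trans (by norm_num) hM
  have hυpos : 0 < υ := by linarith
  have hυne : υ ≠ 0 := hυpos.ne'
  have hυc0 : (υ : ℂ) ≠ 0 := by exact_mod_cast hυne
  have hυ2 : (89 : ℝ) ≤ υ ^ 2 := by nlinarith
  set Λ := farLam υ with hΛdef
  have hΛ9 : 9000000 ≤ Λ := farLam_ge_nine_million υ hυ0
  have hΛsq : 1000 * υ ^ 2 ≤ Λ := farLam_ge_sq hυ0
  have hΛpos : 0 < Λ := by linarith
  -- `ε = 1/υ`, `z̃`, `w`, `L`, `θ`, `s`, `P`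
  set ε : ℝ := 1 / υ with hεdef
  have hε : 0 < ε := div_pos one_pos hυpos
  have hε' : ε ≤ 20 / 189 := by
    rw [hεdef, div_le_div_iff₀ hυpos (by norm_num)]; linarith
  have hε2 : ε ^ 2 = 1 / υ ^ 2 := by rw [hεdef, one_div_pow]
  have hευ : (υ : ℂ) * (ε : ℂ) = 1 := by rw [hεdef]; push_cast; field_simp
  have hεc : (ε : ℂ) = (υ : ℂ)⁻¹ := by rw [hεdef]; push_cast; rw [one_div]
  set z := a / (υ : ℂ) ^ 2 with hzdef
  have hz : ‖z‖ ≤ 9 / 25 := by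
    have hnυ2 : ‖(υ : ℂ) ^ 2‖ = υ ^ 2 := by
      rw [norm_pow, Complex.norm_real, Real.norm_eq_abs, abs_of_pos hυpos]
    rw [hzdef, norm_div, hnυ2, div_le_iff₀ (by positivity)]
    exact ha
  set w := farW z with hwdef
  set L := Complex.log w with hLdef
  set θ : ℂ := L * ((ε : ℂ) * (1 / 4 - w / 2)) with hθdef
  have hξ0 : farXi0 w ε = L + θ := by rw [farXi0, hθdef, hLdef]; ring
  set s : ℂ := (ε : ℂ) * (L + θ) / 4 with hsdef
  set P : ℂ := 2 * s + s ^ 2 with hPdef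
  obtain ⟨hw0, hwlo, hwn, h1s0, h1wP0, hA, hB, hJ1, hJ2⟩ := saddle_estimates hz hε hε' hwdef hLdef hθdef hsdef hPdef
  -- the centre `u₀ = υ(1+s)`, `a = υ²(w⁻¹ − 1)`, `2M − 1 = υ(4Λ − 9 − ε)`
  set u₀ : ℂ := (υ : ℂ) + farXi0 w ε / 4 with hu0def
  have hu0 : u₀ = (υ : ℂ) * (1 + s) := by
    rw [hu0def, hξ0, hsdef]
    linear_combination (-(L + θ) / 4) * hευ
  have ha' : a = (υ : ℂ) ^ 2 * (w⁻¹ - 1) := by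
    have : w⁻¹ = 1 + z := by rw [hwdef, farW, inv_inv]
    rw [this, hzdef]
    field_simp
    ring
  have h2M : (2 * (M : ℂ) - 1) = (υ : ℂ) * (4 * (Λ : ℂ) - 9 - (ε : ℂ)) := by
    have hυε : υ * ε = 1 := by rw [hεdef]; field_simp
    have e1 : (2 * (M : ℝ) - 1) = υ * (4 * Λ - 9 - ε) := by
      simp only [hΛdef, farLam]
      linear_combination (-1 : ℝ) * hmode + hυε
    have e : (2 * (M : ℂ) - 1) = ((2 * (M : ℝ) - 1 : ℝ) : ℂ) := by push_cast; ring
    rw [e, e1]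
    push_cast
    ring
  -- KEY identity `π e^{4u₀} = Λ w e^{θ}`
  have hkey : (π : ℂ) * Complex.exp (4 * u₀) = (Λ : ℂ) * w * Complex.exp θ := by
    have h4u : 4 * u₀ = ((4 * υ : ℝ) : ℂ) + L + θ := by
      rw [hu0def, hξ0]
      push_cast
      ring
    rw [h4u, Complex.exp_add, Complex.exp_add, hLdef, Complex.exp_log hw0]
    simp only [hΛdef, farLam]
    push_cast
    ring
  -- closed forms of `Ψ′(u₀)` and `Ψ″(u₀)`
  have hΨ1 : farPsi1 M a u₀ = -4 * (Λ : ℂ) * w * (Complex.exp θ - (1 + s) / (1 + w * P)) +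
      (9 + (ε : ℂ) / (1 + s) - (9 + (ε : ℂ)) * w * ((1 + s) / (1 + w * P))) := by
    have e4 : 4 * (π : ℂ) * Complex.exp (4 * u₀) = 4 * ((Λ : ℂ) * w * Complex.exp θ) := by rw [mul_assoc, hkey]
    rw [farPsi1, e4, h2M]
    exact saddle_psi1_alg (υ : ℂ) (ε : ℂ) w a s P u₀ (Λ : ℂ) (Complex.exp θ) _ hυc0 hεc hw0 ha' hu0 hPdef rfl
      h1s0 h1wP0
  have hΨ2 : farPsi2 M a u₀ =
      -16 * (Λ : ℂ) * w * (Complex.exp θ - (ε : ℂ) / 4 * ((1 - 2 * w - w * P) / (1 + w * P) ^ 2)) +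
        (-(ε : ℂ) ^ 2 / (1 + s) ^ 2 - (ε : ℂ) * (9 + (ε : ℂ)) * w * ((1 - 2 * w - w * P) / (1 + w * P) ^ 2)) := by
    have e16 : -16 * (π : ℂ) * Complex.exp (4 * u₀) = -16 * ((Λ : ℂ) * w * Complex.exp θ) := by rw [mul_assoc, hkey]
    rw [farPsi2, e16, h2M, saddle_psi2_alg (υ : ℂ) (ε : ℂ) w a s P u₀ (Λ : ℂ) (Complex.exp θ) _ hυc0 hεc hw0 ha' hu0
      hPdef rfl h1s0 h1wP0]
    ring
  -- the two sizes at the centre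
  have hnΛ : ‖(Λ : ℂ)‖ = Λ := by rw [Complex.norm_real, Real.norm_eq_abs, abs_of_pos hΛpos]
  have hΛw0 : 0 ≤ Λ * ‖w‖ := mul_nonneg hΛpos.le (norm_nonneg _)
  have hnΨ1 : ‖farPsi1 M a u₀‖ ≤ 4 * Λ * ‖w‖ * (33 / 100 * ε ^ 2) + 25 := by
    rw [hΨ1]
    have eX : ‖-4 * (Λ : ℂ) * w * (Complex.exp θ - (1 + s) / (1 + w * P))‖ =
        4 * Λ * ‖w‖ * ‖Complex.exp θ - (1 + s) / (1 + w * P)‖ := by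
      rw [norm_mul, norm_mul, norm_mul, hnΛ]
      have : ‖(-4 : ℂ)‖ = 4 := by simp
      rw [this]
    calc _ ≤ ‖-4 * (Λ : ℂ) * w * (Complex.exp θ - (1 + s) / (1 + w * P))‖ +
          ‖(9 + (ε : ℂ) / (1 + s) - (9 + (ε : ℂ)) * w * ((1 + s) / (1 + w * P)))‖ := norm_add_le _ _
      _ ≤ 4 * Λ * ‖w‖ * (33 / 100 * ε ^ 2) + 25 := by
          rw [eX]
          exact add_le_add (mul_le_mul_of_nonneg_left hA (by linarith)) hJ1
  set d := farPsi2 M a u₀ with hddef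
  have hnΨ2 : 16 * Λ * ‖w‖ * (9 / 10) - 4 ≤ ‖d‖ := by
    rw [hΨ2]
    set X : ℂ := -16 * (Λ : ℂ) * w * (Complex.exp θ - (ε : ℂ) / 4 * ((1 - 2 * w - w * P) / (1 + w * P) ^ 2)) with hX
    set J : ℂ := -(ε : ℂ) ^ 2 / (1 + s) ^ 2 -
      (ε : ℂ) * (9 + (ε : ℂ)) * w * ((1 - 2 * w - w * P) / (1 + w * P) ^ 2) with hJ
    have eX : ‖X‖ = 16 * Λ * ‖w‖ * ‖Complex.exp θ - (ε : ℂ) / 4 * ((1 - 2 * w - w * P) / (1 + w * P) ^ 2)‖ := by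
      rw [hX, norm_mul, norm_mul, norm_mul, hnΛ]
      have : ‖(-16 : ℂ)‖ = 16 := by simp
      rw [this]
    have h1 : ‖X‖ ≤ ‖X + J‖ + ‖J‖ := by
      have := norm_sub_le (X + J) J
      rwa [add_sub_cancel_right] at this
    have h2 : 16 * Λ * ‖w‖ * (9 / 10) ≤ ‖X‖ := by
      rw [eX]; exact mul_le_mul_of_nonneg_left hB (by linarith)
    linarith
  -- the disc lies in the window box (uses (L0))
  obtain ⟨hIm0, hRe0⟩ := wanted_xi0_box z hz ε hε hε'
  set ρ : ℝ := 1 / (10 * υ ^ 2) with hρdef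
  have hρpos : 0 < ρ := by rw [hρdef]; positivity
  have hρ890 : ρ ≤ 1 / 890 := by
    rw [hρdef]; exact one_div_le_one_div_of_le (by norm_num) (by linarith)
  have hu0re : u₀.re = υ + (farXi0 w ε).re / 4 := by rw [hu0def]; simp
  have hu0im : u₀.im = (farXi0 w ε).im / 4 := by rw [hu0def]; simp
  have hbox : ∀ u ∈ closedBall u₀ ρ, |u.re - υ| ≤ 1 / 4 ∧ |u.im| ≤ 1 / 10 := by
    intro u hu
    rw [mem_closedBall, dist_eq_norm] at hu
    have hre := (Complex.abs_re_le_norm (u - u₀)).trans hu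
    have him := (Complex.abs_im_le_norm (u - u₀)).trans hu
    rw [Complex.sub_re, hu0re] at hre
    rw [Complex.sub_im, hu0im] at him
    obtain ⟨hre1, hre2⟩ := abs_le.mp hre
    obtain ⟨him1, him2⟩ := abs_le.mp him
    obtain ⟨hR1, hR2⟩ := abs_le.mp hRe0
    obtain ⟨hI1, hI2⟩ := abs_le.mp hIm0
    constructor
    · rw [abs_le]; constructor <;> linarith
    · rw [abs_le]; constructor <;> linarith
  have hgood : ∀ u ∈ closedBall u₀ ρ, 0 < u.re ∧ u ^ 2 + a ∈ slitPlane ∧ ‖farPsi3 M a u‖ ≤ 180 * Λ := by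
    intro u hu
    obtain ⟨hx, hy⟩ := hbox u hu
    have hx1 := (abs_le.mp hx).1
    have hxυ : υ - 2 ≤ u.re := by linarith
    have heq : ((u.re : ℂ) + u.im * I) = u := Complex.re_add_im u
    refine ⟨by linarith, ?_, ?_⟩
    · have h := sq_add_mem_slitPlane hυ0 ha hxυ hy
      rwa [heq] at h
    · have h := norm_farPsi3_le M hM1 ⟨hυ0, hmode⟩ ha hx hy
      rwa [heq] at h
  -- `Ψ″` is `180Λ`-Lipschitz on the disc
  have hlipd : ∀ u ∈ closedBall u₀ ρ, ‖farPsi2 M a u - d‖ ≤ 180 * Λ * ρ := by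
    intro u hu
    have hmv := Convex.norm_image_sub_le_of_norm_hasDerivWithin_le (f := farPsi2 M a) (f' := farPsi3 M a)
      (s := closedBall u₀ ρ) (C := 180 * Λ)
      (fun v hv => (hasDerivAt_farPsi2 M a (hgood v hv).1 (hgood v hv).2.1).hasDerivWithinAt)
      (fun v hv => (hgood v hv).2.2) (convex_closedBall u₀ ρ) (mem_closedBall_self hρpos.le) hu
    rw [mem_closedBall, dist_eq_norm] at hu
    calc ‖farPsi2 M a u - d‖ ≤ 180 * Λ * ‖u - u₀‖ := hmv
      _ ≤ 180 * Λ * ρ := by gcongr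
  -- sizes of `d`, `q`
  have h180 : 180 * Λ * ρ = 18 * Λ / υ ^ 2 := by rw [hρdef]; field_simp; ring
  have h18 : 18 * Λ / υ ^ 2 ≤ 18 * Λ / 89 := div_le_div_of_nonneg_left (by linarith) (by norm_num) hυ2
  have hΛW : Λ * (25 / 34) ≤ Λ * ‖w‖ := mul_le_mul_of_nonneg_left hwlo hΛpos.le
  have hd18 : 180 * Λ * ρ < ‖d‖ := by rw [h180]; linarith
  have hdpos : 0 < ‖d‖ := by linarith
  have hd0 : d ≠ 0 := norm_pos_iff.mp hdpos
  set q : ℝ := 180 * Λ * ρ / ‖d‖ with hqdef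
  have hq0 : 0 ≤ q := div_nonneg (by positivity) (norm_nonneg _)
  have hq1 : q < 1 := (div_lt_one hdpos).mpr hd18
  have hqd : q * ‖d‖ = 180 * Λ * ρ := div_mul_cancel₀ _ hdpos.ne'
  -- the Newton–Kantorovich smallness `‖Ψ′(u₀)‖ ≤ (1 − q)ρ‖d‖`
  have hsmall : ‖farPsi1 M a u₀‖ ≤ (1 - q) * ρ * ‖d‖ := by
    have e1 : (1 - q) * ρ * ‖d‖ = ρ * ‖d‖ - ρ * (180 * Λ * ρ) := by rw [← hqd]; ring
    have key : 250 * υ ^ 2 + 18 * Λ / υ ^ 2 + 4 ≤ 12 / 10 * Λ * ‖w‖ := by linarith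
    have eL : 4 * Λ * ‖w‖ * (33 / 100 * ε ^ 2) + 25 = (132 / 10 * Λ * ‖w‖ + 250 * υ ^ 2) / (10 * υ ^ 2) := by
      rw [hε2]; field_simp; ring
    have eR : ρ * ‖d‖ - ρ * (180 * Λ * ρ) = (‖d‖ - 18 * Λ / υ ^ 2) / (10 * υ ^ 2) := by
      rw [hρdef]; field_simp; ring
    refine hnΨ1.trans ?_
    rw [e1, eL, eR]
    exact div_le_div_of_nonneg_right (by linarith) (by positivity)
  -- Newton–Kantorovich
  obtain ⟨u_s, hus, hzero, -⟩ := WindowEGF.exists_zero_near_of_hasDerivAt (g := farPsi1 M a)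
    (g' := farPsi2 M a) hρpos.le hd0 hq0 hq1
    (fun u hu => hasDerivAt_farPsi1 M a (hgood u hu).1 (hgood u hu).2.1)
    (fun u hu => by rw [hqd]; exact hlipd u hu) hsmall
  exact ⟨u_s, hus, by rw [hzero, norm_zero]; norm_num⟩

end Summit.RiemannHypothesis.RiemannHypothesis.Theorems.JensenPolynomials.FarGumbel

end
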